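import Summits.CriticalPhenomena.PercolationContinuityZ3.Theorems.PercNearOneGluingNoHeavyPcintBSMRLaw
import Summits.CriticalPhenomena.PercolationContinuityZ3.Theorems.PercNearOneGluingNoHeavyPcintBSMXFourier
import HarnessLib

/-!
# PCINT lane, PHASE 9 (block renewal with reach-`m` pieces), step 3: Fourier representation and Laplace bound

Cell `prim-pcint`, seat `prim-pcint-1` (gen 17); memo `run/shared/lean/prim/pcint/T-FIBRE-ROUTE.md` §PHASE 9.

The reach-`m` analogue of …PcintBSMXFourier.  For a symmetric law `g` on the letters `Fin (2m+1)` (…PcintBSMRLaw)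
the symbol is `φ(θ) = Σ_c g c · cos (val c · θ)` (`BSMR.sym`); the `n`-fold convolution has the Fourier representation
`2π · H m g n δ = ∫_{-π}^{π} φ(θ)ⁿ cos(δθ) dθ` (**`BSMR.integral_sym_pow_mul_cos`**, real trigonometric-polynomial
induction), and Laplace's method with explicit constants gives (**`BSMR.H_le_fourier`**)

  `H m g n δ ≤ 1/(2√(π c n)) + e^{-m₀ n}`   (`n ≥ 1`),

whenever the law is concentrated (`2 g(0) ≥ 1`, so `φ ≥ 0`), `0 < θ₀`, `m θ₀ ≤ 1`,
`0 < c ≤ s₂/2 - (5/96) θ₀² s₄` with the moments `s₂ = Σ_c g c (val c)²`, `s₄ = Σ_c g c (val c)⁴` (region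
`|θ| ≤ θ₀`, `1 - cos x ≥ x²/2 - (5/96)x⁴` on `|x| ≤ 1`, Mathlib `Real.cos_bound`), and
`m₀ ≤ (g(-1) + g(1)) · L(θ₀)` (region `θ₀ ≤ |θ| ≤ π`: `cos` is monotone on `[0, π]`, the other harmonics are dropped).
As `θ₀ → 0`, `c → s₂/2 = σ²/2` and the main term is the local central limit constant `1/√(2πσ²n)`.
The elementary lemmas `BSMX.Lcos_le`, `BSMX.pow_le_exp_neg`, `BSMX.integral_exp_neg_mul_sq_le`, `BSMX.sqrt_div_two_pi`
of the `m = 2` file are reused.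
-/

noncomputable section

namespace Summit.CriticalPhenomena.PercolationContinuityZ3.Theorems.Pcint.BSMR

open Finset Real MeasureTheory intervalIntegral Set

variable {m : ℕ}

/-! ### The symbol -/

/-- **The symbol of the law**: `φ(θ) = Σ_c g c · cos (val c · θ)`. -/
def sym (m : ℕ) (g : Fin (2 * m + 1) → ℝ) (θ : ℝ) : ℝ := ∑ c : Fin (2 * m + 1), g c * Real.cos (val m c * θ)

/-- The symbol is continuous. -/
theorem continuous_sym (g : Fin (2 * m + 1) → ℝ) : Continuous (sym m g) := by
  unfold sym
  exact continuous_finsetSum _ fun c _ => by fun_prop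

/-- `1 - φ(θ) = Σ_c g c (1 - cos (val c · θ))`. -/
theorem one_sub_sym {g : Fin (2 * m + 1) → ℝ} (hg : LawOK m g) (θ : ℝ) :
    1 - sym m g θ = ∑ c : Fin (2 * m + 1), g c * (1 - Real.cos (val m c * θ)) := by
  unfold sym
  simp_rw [mul_sub, mul_one, sum_sub_distrib, hg.sum_one]

/-- `φ ≤ 1`. -/
theorem sym_le_one {g : Fin (2 * m + 1) → ℝ} (hg : LawOK m g) (θ : ℝ) : sym m g θ ≤ 1 := by
  have h := one_sub_sym hg θ
  have : 0 ≤ ∑ c : Fin (2 * m + 1), g c * (1 - Real.cos (val m c * θ)) :=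
    sum_nonneg fun c _ => mul_nonneg (hg.nonneg c) (sub_nonneg.2 (Real.cos_le_one _))
  linarith

/-- The central letter (value `0`). -/
def ctr (m : ℕ) : Fin (2 * m + 1) := ⟨m, by omega⟩

/-- The central letter has value `0`. -/
theorem val_ctr : val m (ctr m) = 0 := by unfold val ctr; simp

/-- **`φ ≥ 0` when the law is concentrated** (`2 g(0) ≥ 1`: the weight at `0` dominates). -/
theorem sym_nonneg {g : Fin (2 * m + 1) → ℝ} (hg : LawOK m g) (hctr : 1 ≤ 2 * g (ctr m)) (θ : ℝ) : 0 ≤ sym m g θ := by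
  unfold sym
  have hterm : ∀ c : Fin (2 * m + 1), (if c = ctr m then 2 * g c else 0) - g c ≤ g c * Real.cos (val m c * θ) := by
    intro c
    split_ifs with h
    · subst h; rw [val_ctr]; simp only [Int.cast_zero, zero_mul, Real.cos_zero, mul_one]; linarith
    · have := Real.neg_one_le_cos (val m c * θ); nlinarith [hg.nonneg c]
  have hsum := sum_le_sum fun c (_ : c ∈ (univ : Finset (Fin (2 * m + 1)))) => hterm c
  rw [sum_sub_distrib, sum_ite_eq', if_pos (Finset.mem_univ _), hg.sum_one] at hsum
  linarith

/-! ### The Fourier representation -/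

/-- The symbol times a cosine: `φ(θ) cos(δθ) = Σ_c (g c / 2) (cos((δ - v_c)θ) + cos((δ + v_c)θ))`. -/
theorem sym_mul_cos (g : Fin (2 * m + 1) → ℝ) (δ : ℤ) (θ : ℝ) : sym m g θ * Real.cos (δ * θ) =
    ∑ c : Fin (2 * m + 1), g c / 2 *
      (Real.cos (((δ - val m c : ℤ) : ℝ) * θ) + Real.cos (((δ + val m c : ℤ) : ℝ) * θ)) := by
  have pts : ∀ a b : ℝ, Real.cos a * Real.cos b = (Real.cos (a - b) + Real.cos (a + b)) / 2 := fun a b => by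
    rw [Real.cos_sub, Real.cos_add]; ring
  unfold sym
  rw [sum_mul]
  refine sum_congr rfl fun c _ => ?_
  rw [mul_assoc, pts (val m c * θ) (δ * θ)]
  push_cast
  rw [show (val m c : ℝ) * θ - δ * θ = -((δ - val m c) * θ) by ring, Real.cos_neg,
    show (val m c : ℝ) * θ + δ * θ = (δ + val m c) * θ by ring]
  ring

/-- One step of the symbol recursion under the integral sign (pointwise). -/
theorem sym_pow_succ_mul_cos (g : Fin (2 * m + 1) → ℝ) (n : ℕ) (δ : ℤ) (θ : ℝ) :
    sym m g θ ^ (n + 1) * Real.cos (δ * θ) =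
      (∑ c : Fin (2 * m + 1), g c / 2 * (sym m g θ ^ n * Real.cos (((δ - val m c : ℤ) : ℝ) * θ))) +
        ∑ c : Fin (2 * m + 1), g c / 2 * (sym m g θ ^ n * Real.cos (((δ + val m c : ℤ) : ℝ) * θ)) := by
  rw [pow_succ, mul_assoc, sym_mul_cos, mul_sum, ← sum_add_distrib]
  refine sum_congr rfl fun c _ => ?_
  ring

/-- **The Fourier representation**: `∫_{-π}^{π} φ(θ)ⁿ cos(δθ) dθ = 2π · H m g n δ`. -/
theorem integral_sym_pow_mul_cos {g : Fin (2 * m + 1) → ℝ} (hg : LawOK m g) : ∀ (n : ℕ) (δ : ℤ),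
    ∫ θ in (-π)..π, sym m g θ ^ n * Real.cos (δ * θ) = 2 * π * H m g n δ
  | 0, δ => by
    simp_rw [pow_zero, one_mul]
    rw [H_zero]
    split_ifs with hδ
    · rw [hδ]; simp only [Int.cast_zero, zero_mul, Real.cos_zero]
      rw [intervalIntegral.integral_const, smul_eq_mul]; ring
    · have hδ' : (δ : ℝ) ≠ 0 := by exact_mod_cast hδ
      rw [intervalIntegral.integral_comp_mul_left (fun x => Real.cos x) hδ', integral_cos,
        show (δ : ℝ) * -π = -(δ * π) by ring, Real.sin_neg, Real.sin_int_mul_pi]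
      simp
  | n + 1, δ => by
    have hc := continuous_sym (m := m) g
    have hint : ∀ (e : ℤ), IntervalIntegrable (fun θ => sym m g θ ^ n * Real.cos ((e : ℝ) * θ)) volume (-π) π :=
      fun e => (Continuous.intervalIntegrable (by fun_prop) _ _)
    simp_rw [sym_pow_succ_mul_cos g n δ]
    rw [intervalIntegral.integral_add, intervalIntegral.integral_finsetSum, intervalIntegral.integral_finsetSum]
    · simp_rw [intervalIntegral.integral_const_mul, integral_sym_pow_mul_cos hg n]
      have s1 : ∑ c : Fin (2 * m + 1), g c / 2 * (2 * π * H m g n (δ - val m c)) =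
          π * ∑ c : Fin (2 * m + 1), g c * H m g n (δ - val m c) := by
        rw [mul_sum]; exact sum_congr rfl fun c _ => by ring
      have s2 : ∑ c : Fin (2 * m + 1), g c / 2 * (2 * π * H m g n (δ + val m c)) =
          π * ∑ c : Fin (2 * m + 1), g c * H m g n (δ + val m c) := by
        rw [mul_sum]; exact sum_congr rfl fun c _ => by ring
      rw [s1, s2, ← H_succ, ← H_succ' hg]
      ring
    · exact fun c _ => (hint _).const_mul _
    · exact fun c _ => (hint _).const_mul _
    · exact (continuous_finsetSum _ fun c _ => (by fun_prop : Continuous fun θ =>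
        g c / 2 * (sym m g θ ^ n * Real.cos (((δ - val m c : ℤ) : ℝ) * θ)))).intervalIntegrable _ _
    · exact (continuous_finsetSum _ fun c _ => (by fun_prop : Continuous fun θ =>
        g c / 2 * (sym m g θ ^ n * Real.cos (((δ + val m c : ℤ) : ℝ) * θ)))).intervalIntegrable _ _

/-- The Fourier representation solved for `H`: `H n δ = (2π)⁻¹ ∫_{-π}^{π} φⁿ cos(δθ)`. -/
theorem H_eq_integral {g : Fin (2 * m + 1) → ℝ} (hg : LawOK m g) (n : ℕ) (δ : ℤ) :
    H m g n δ = (∫ θ in (-π)..π, sym m g θ ^ n * Real.cos (δ * θ)) / (2 * π) := by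
  rw [integral_sym_pow_mul_cos hg, mul_div_cancel_left₀ _ (by positivity : (2 : ℝ) * π ≠ 0)]

/-! ### Pointwise bounds for the symbol -/

/-- The second moment of the law: `s₂ = Σ_c g c (val c)²`. -/
def s₂ (m : ℕ) (g : Fin (2 * m + 1) → ℝ) : ℝ := ∑ c : Fin (2 * m + 1), g c * (val m c : ℝ) ^ 2

/-- The fourth moment of the law: `s₄ = Σ_c g c (val c)⁴`. -/
def s₄ (m : ℕ) (g : Fin (2 * m + 1) → ℝ) : ℝ := ∑ c : Fin (2 * m + 1), g c * (val m c : ℝ) ^ 4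

/-- **Region A** (`|θ| ≤ θ₀`, `m θ₀ ≤ 1`): `1 - φ(θ) ≥ c θ²` whenever `c ≤ s₂/2 - (5/96) θ₀² s₄`. -/
theorem sq_mul_le_one_sub_sym {g : Fin (2 * m + 1) → ℝ} (hg : LawOK m g) {θ₀ c θ : ℝ}
    (hmθ : (m : ℝ) * θ₀ ≤ 1) (hc : c ≤ s₂ m g / 2 - 5 / 96 * θ₀ ^ 2 * s₄ m g) (hθ : |θ| ≤ θ₀) :
    c * θ ^ 2 ≤ 1 - sym m g θ := by
  rw [one_sub_sym hg]
  have hsq : θ ^ 2 ≤ θ₀ ^ 2 := by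
    have := sq_abs θ; rw [← this]; exact pow_le_pow_left₀ (abs_nonneg θ) hθ 2
  have ht2 : 0 ≤ θ ^ 2 := sq_nonneg θ
  -- termwise: `g c (1 - cos (v θ)) ≥ g c ((vθ)²/2 - (5/96)(vθ)⁴)`
  have hterm : ∀ c : Fin (2 * m + 1), g c * ((val m c : ℝ) ^ 2 * θ ^ 2 / 2 - 5 / 96 * ((val m c : ℝ) ^ 4 * θ ^ 4)) ≤
      g c * (1 - Real.cos (val m c * θ)) := by
    intro c
    refine mul_le_mul_of_nonneg_left ?_ (hg.nonneg c)
    have hv : |(val m c : ℝ) * θ| ≤ 1 := by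
      rw [abs_mul]
      have h1 : |(val m c : ℝ)| ≤ m := by exact_mod_cast abs_val_le (m := m) c
      calc |(val m c : ℝ)| * |θ| ≤ (m : ℝ) * θ₀ := mul_le_mul h1 hθ (abs_nonneg θ) (Nat.cast_nonneg m)
        _ ≤ 1 := hmθ
    have := BSMX.Lcos_le hv
    unfold BSMX.Lcos at this
    calc (val m c : ℝ) ^ 2 * θ ^ 2 / 2 - 5 / 96 * ((val m c : ℝ) ^ 4 * θ ^ 4)
        = ((val m c : ℝ) * θ) ^ 2 / 2 - 5 / 96 * ((val m c : ℝ) * θ) ^ 4 := by ring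
      _ ≤ _ := this
  have hsum := sum_le_sum fun c (_ : c ∈ (univ : Finset (Fin (2 * m + 1)))) => hterm c
  -- the left side is `θ² s₂/2 - (5/96) θ⁴ s₄`
  have hL : ∑ c : Fin (2 * m + 1), g c * ((val m c : ℝ) ^ 2 * θ ^ 2 / 2 - 5 / 96 * ((val m c : ℝ) ^ 4 * θ ^ 4)) =
      θ ^ 2 / 2 * s₂ m g - 5 / 96 * θ ^ 4 * s₄ m g := by
    unfold s₂ s₄
    rw [Finset.mul_sum, Finset.mul_sum, ← sum_sub_distrib]
    refine sum_congr rfl fun c _ => ?_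
    ring
  rw [hL] at hsum
  have hs4 : 0 ≤ s₄ m g := sum_nonneg fun c _ => mul_nonneg (hg.nonneg c) (by positivity)
  -- `θ⁴ s₄ ≤ θ² θ₀² s₄`
  have h4 : θ ^ 4 * s₄ m g ≤ θ ^ 2 * θ₀ ^ 2 * s₄ m g := by
    rw [show θ ^ 4 = θ ^ 2 * θ ^ 2 by ring]
    exact mul_le_mul_of_nonneg_right (mul_le_mul_of_nonneg_left hsq ht2) hs4
  have key : c * θ ^ 2 ≤ θ ^ 2 / 2 * s₂ m g - 5 / 96 * θ ^ 4 * s₄ m g := by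
    have := mul_le_mul_of_nonneg_left hc ht2
    nlinarith
  linarith

/-- The letters of value `±1` (for `m ≥ 1`). -/
def oneP (m : ℕ) : Fin (2 * m + 1) := ⟨min (m + 1) (2 * m), by omega⟩

/-- The letter of value `-1` (for `m ≥ 1`). -/
def oneN (m : ℕ) : Fin (2 * m + 1) := ⟨m - 1, by omega⟩

/-- Values of the unit letters. -/
theorem val_one (hm : 1 ≤ m) : val m (oneP m) = 1 ∧ val m (oneN m) = -1 := by
  unfold val oneP oneN; constructor <;> simp <;> omega

/-- **Region B** (`θ₀ ≤ |θ| ≤ π`, `θ₀ ≤ 1`): `1 - φ(θ) ≥ m₀` whenever `m₀ ≤ (g(-1) + g(1)) L(θ₀)`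
(the unit harmonics only; `cos` is monotone on `[0, π]`). -/
theorem le_one_sub_sym {g : Fin (2 * m + 1) → ℝ} (hg : LawOK m g) (hm : 1 ≤ m) {θ₀ m₀ θ : ℝ} (hθ₀0 : 0 ≤ θ₀)
    (hθ₀1 : θ₀ ≤ 1) (hmB : m₀ ≤ (g (oneN m) + g (oneP m)) * BSMX.Lcos θ₀) (hθ1 : θ₀ ≤ |θ|) (hθ2 : |θ| ≤ π) :
    m₀ ≤ 1 - sym m g θ := by
  rw [one_sub_sym hg]
  have hne : oneN m ≠ oneP m := by
    intro h; have := congr_arg Fin.val h; simp [oneN, oneP] at this; omega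
  obtain ⟨v1, v2⟩ := val_one hm
  -- keep only the two unit letters
  have hsub : ∑ c ∈ ({oneN m, oneP m} : Finset (Fin (2 * m + 1))), g c * (1 - Real.cos (val m c * θ)) ≤
      ∑ c : Fin (2 * m + 1), g c * (1 - Real.cos (val m c * θ)) :=
    sum_le_sum_of_subset_of_nonneg (subset_univ _) fun c _ _ =>
      mul_nonneg (hg.nonneg c) (sub_nonneg.2 (Real.cos_le_one _))
  rw [sum_pair hne, v1, v2] at hsub
  push_cast at hsub
  rw [show ((-1 : ℝ)) * θ = -θ by ring, Real.cos_neg, one_mul] at hsub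
  -- `1 - cos θ ≥ 1 - cos θ₀ ≥ L(θ₀)`
  have c1 : Real.cos θ ≤ Real.cos θ₀ := by
    rw [← Real.cos_abs θ]
    exact Real.cos_le_cos_of_nonneg_of_le_pi hθ₀0 hθ2 hθ1
  have l1 := BSMX.Lcos_le (x := θ₀) (by rw [abs_of_nonneg hθ₀0]; exact hθ₀1)
  have hgg : 0 ≤ g (oneN m) + g (oneP m) := add_nonneg (hg.nonneg _) (hg.nonneg _)
  have := mul_le_mul_of_nonneg_left (l1.trans (by linarith : 1 - Real.cos θ₀ ≤ 1 - Real.cos θ)) hgg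
  linarith

/-- **The pointwise bound on `[-π, π]`**: `φ(θ)ⁿ ≤ exp(-(n c) θ²) + exp(-(n m₀))`. -/
theorem sym_pow_le {g : Fin (2 * m + 1) → ℝ} (hg : LawOK m g) (hm : 1 ≤ m) (hctr : 1 ≤ 2 * g (ctr m))
    {θ₀ c m₀ : ℝ} (hθ₀0 : 0 ≤ θ₀) (hmθ : (m : ℝ) * θ₀ ≤ 1) (hc : c ≤ s₂ m g / 2 - 5 / 96 * θ₀ ^ 2 * s₄ m g)
    (hmB : m₀ ≤ (g (oneN m) + g (oneP m)) * BSMX.Lcos θ₀) (n : ℕ) {θ : ℝ} (hθ : |θ| ≤ π) :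
    sym m g θ ^ n ≤ Real.exp (-((n : ℝ) * c) * θ ^ 2) + Real.exp (-((n : ℝ) * m₀)) := by
  have hθ₀1 : θ₀ ≤ 1 := by
    have h1 : (1 : ℝ) ≤ m := by exact_mod_cast hm
    nlinarith
  have hs := sym_nonneg hg hctr θ
  have h0 := BSMX.pow_le_exp_neg hs n
  have eA := Real.exp_pos (-((n : ℝ) * c) * θ ^ 2)
  have eB := Real.exp_pos (-((n : ℝ) * m₀))
  rcases le_or_gt |θ| θ₀ with hA | hBC
  · have hq := sq_mul_le_one_sub_sym hg hmθ hc hA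
    have : Real.exp (-((n : ℝ) * (1 - sym m g θ))) ≤ Real.exp (-((n : ℝ) * c) * θ ^ 2) := by
      rw [Real.exp_le_exp]
      have := mul_le_mul_of_nonneg_left hq (Nat.cast_nonneg n)
      linarith
    linarith
  · have hq := le_one_sub_sym hg hm hθ₀0 hθ₀1 hmB hBC.le hθ
    have : Real.exp (-((n : ℝ) * (1 - sym m g θ))) ≤ Real.exp (-((n : ℝ) * m₀)) := by
      rw [Real.exp_le_exp]
      have := mul_le_mul_of_nonneg_left hq (Nat.cast_nonneg n)
      linarith
    linarith

/-! ### The Laplace bound -/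

/-- **The near-sharp dispersion bound (Laplace's method on the Fourier representation)**: for a symmetric law with
`2 g(0) ≥ 1`, `m ≥ 1`, `0 < θ₀`, `m θ₀ ≤ 1`, `0 < c ≤ s₂/2 - (5/96) θ₀² s₄`, `m₀ ≤ (g(-1) + g(1)) L(θ₀)`, and every
`n ≥ 1`, `δ`:  `H m g n δ ≤ 1 / (2 √(π c n)) + exp(-m₀ n)`. -/
theorem H_le_fourier {g : Fin (2 * m + 1) → ℝ} (hg : LawOK m g) (hm : 1 ≤ m) (hctr : 1 ≤ 2 * g (ctr m))
    {θ₀ c m₀ : ℝ} (hθ₀0 : 0 < θ₀) (hmθ : (m : ℝ) * θ₀ ≤ 1) (hc0 : 0 < c)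
    (hc : c ≤ s₂ m g / 2 - 5 / 96 * θ₀ ^ 2 * s₄ m g) (hmB : m₀ ≤ (g (oneN m) + g (oneP m)) * BSMX.Lcos θ₀)
    {n : ℕ} (hn : 1 ≤ n) (δ : ℤ) :
    H m g n δ ≤ 1 / (2 * Real.sqrt (π * c * n)) + Real.exp (-(m₀ * n)) := by
  have hπ := Real.pi_pos
  have hnR : (0 : ℝ) < n := by exact_mod_cast hn
  have hb : 0 < (n : ℝ) * c := by positivity
  have hcs := continuous_sym (m := m) g
  -- pointwise: `φⁿ cos(δθ) ≤ exp(-(nc) θ²) + exp(-(n m₀))` on `[-π, π]`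
  have hpt : ∀ θ ∈ Icc (-π) π, sym m g θ ^ n * Real.cos (δ * θ) ≤
      Real.exp (-((n : ℝ) * c) * θ ^ 2) + Real.exp (-((n : ℝ) * m₀)) := by
    intro θ hθ
    have habs : |θ| ≤ π := abs_le.2 ⟨hθ.1, hθ.2⟩
    have hsn : 0 ≤ sym m g θ ^ n := pow_nonneg (sym_nonneg hg hctr θ) n
    calc sym m g θ ^ n * Real.cos (δ * θ) ≤ sym m g θ ^ n * 1 :=
          mul_le_mul_of_nonneg_left (Real.cos_le_one _) hsn
      _ ≤ _ := by rw [mul_one]; exact sym_pow_le hg hm hctr hθ₀0.le hmθ hc hmB n habs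
  have hmono : ∫ θ in (-π)..π, sym m g θ ^ n * Real.cos (δ * θ) ≤
      ∫ θ in (-π)..π, (Real.exp (-((n : ℝ) * c) * θ ^ 2) + Real.exp (-((n : ℝ) * m₀))) :=
    intervalIntegral.integral_mono_on (by linarith) ((by fun_prop : Continuous fun θ =>
      sym m g θ ^ n * Real.cos (δ * θ)).intervalIntegrable _ _)
      ((by fun_prop : Continuous fun θ : ℝ =>
        Real.exp (-((n : ℝ) * c) * θ ^ 2) + Real.exp (-((n : ℝ) * m₀))).intervalIntegrable _ _) hpt
  have hsplit : ∫ θ in (-π)..π, (Real.exp (-((n : ℝ) * c) * θ ^ 2) + Real.exp (-((n : ℝ) * m₀))) =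
      (∫ θ in (-π)..π, Real.exp (-((n : ℝ) * c) * θ ^ 2)) + 2 * π * Real.exp (-((n : ℝ) * m₀)) := by
    rw [intervalIntegral.integral_add ((by fun_prop : Continuous fun θ : ℝ =>
        Real.exp (-((n : ℝ) * c) * θ ^ 2)).intervalIntegrable _ _) (intervalIntegrable_const),
      intervalIntegral.integral_const, smul_eq_mul]
    ring
  have hgi := BSMX.integral_exp_neg_mul_sq_le hb
  rw [H_eq_integral hg, div_le_iff₀ (by positivity : (0 : ℝ) < 2 * π)]
  calc ∫ θ in (-π)..π, sym m g θ ^ n * Real.cos (δ * θ)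
      ≤ Real.sqrt (π / ((n : ℝ) * c)) + 2 * π * Real.exp (-((n : ℝ) * m₀)) := by rw [hsplit] at hmono; linarith
    _ = (1 / (2 * Real.sqrt (π * c * n)) + Real.exp (-(m₀ * n))) * (2 * π) := by
        rw [← BSMX.sqrt_div_two_pi hc0 hnR, show -(m₀ * (n : ℝ)) = -((n : ℝ) * m₀) by ring]
        field_simp

end Summit.CriticalPhenomena.PercolationContinuityZ3.Theorems.Pcint.BSMR

end
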